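import Mathlib
import Literature.Analysis.Convex.LinearProgramSharpness
import HarnessLib

/-!
# Semidefinite programs are not sharp: the Hölder exponent `1/2` of the PSD cone
# (Drusvyatskiy–Wolkowicz, *Found. Trends Optim.* 3 (2017), §5, Example 5.1 with `n = 2`)

Sources.
* [DrusvyatskiyWolkowicz2017] D. Drusvyatskiy, H. Wolkowicz, *The many faces of degeneracy in conic
  optimization*, Found. Trends Optim. 3 (2017) 77–170 (arXiv:1706.03705), §5 "Singularity degree and
  the Hölder error bound in SDP": Theorem 5.1 (Sturm's Hölderian error bound
  `dist_F(X) ≤ c (dist^{2^{-d}}(X, Sⁿ₊) + dist^{2^{-d}}(X, V))` on compact sets, `d` = singularity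
  degree) and **Example 5.1 (worst-case example)**: `F = {X ∈ Sⁿ₊ : X₂₂ = 0, X_{k+1,k+1} = X_{1k}}`;
  "for any feasible `X`, the constraint `X₂₂ = 0` forces `0 = X₁₂`"; the matrices `X(ε)` violate only
  `X₂₂ = 0`, by `ε`, while their distance to `F` is at least of order `ε^{2^{-(n-1)}}` — "the Hölder
  exponent … is sharp". We formalize the case `n = 2` (exponent `1/2`), reparametrised `ε ↦ ε²`.
* [ApplegateEtAl2022] Applegate–Hinder–Lu–Lubin, Math. Program. 201 (2023), Definition 1 (sharpness
  of a primal–dual problem, tree: `RestartedPDHG.IsSharpOn`) — the hypothesis of their restart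
  theorems (tree: `RestartedPDHG.infDistM_iterate_avgPDHG_le_pow`, `infDistM_adaptive_avgPDHG_le`).

Contents (all proved; no named facts).
* `psd2` = the cone `S²₊` in coordinates `x = (X₁₁, X₁₂, X₂₂) ∈ ℝ³` (`mem_psd2_iff_posSemidef`: it IS
  Mathlib's `Matrix.PosSemidef` of `sym2 x`), `offDiag_eq_zero_of_mem_psd2` (the printed mechanism
  `X ⪰ 0, X₂₂ = 0 ⇒ X₁₂ = 0`), `mem_feas2_iff` (`F = cone(e₁e₁ᵀ)`).
* Example 5.1, `n = 2`, AS PRINTED: `xeps ε = (1 ε; ε ε²) ⪰ 0`, `infDist_xeps_lin2_le`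
  (`dist(X(ε), V) ≤ ε²`), `infDist_xeps_psd2` (`= 0`), `le_infDist_xeps_feas2` (`dist(X(ε), F) ≥ |ε|`),
  and **`not_lipschitz_errorBound_psd2`**: there is NO `κ` with
  `dist(X, F) ≤ κ (dist(X, S²₊) + dist(X, V))` on the unit ball around `e₁e₁ᵀ` (the Hölder exponent is
  genuinely `≤ 1/2`; no Hoffman-type bound for this spectrahedron).
* The same mechanism read through [ApplegateEtAl2022, Definition 1] (our corollary, stated in the
  tree's conic-saddle vocabulary): the SDP `min X₂₂ s.t. X₁₁ = 1, X ⪰ 0` (`Ksdp`, `csdp`, `bsdp`,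
  Lagrangian `conicL_sdp : L(X, y) = X₂₂ + (X₁₁ − 1)y`) has the unique primal–dual solution
  `z* = (e₁e₁ᵀ, 0)` (`saddleSet_sdp`; zero duality gap, strict complementarity `X* + S* = I`), the
  feasible points `z(ε) = (X(ε), 0)` have normalized duality gap `ρ_r(z(ε)) ≤ ε²/r` (`rho_zeps_le`)
  but `‖z(ε) − z*‖ ≥ ε` (`norm_zeps_sub`), hence **`not_isSharpOn_sdp`**: for every `α > 0`, `R > 0`
  and all PDHG steps `τ, σ > 0`, `τσ‖K‖² < 1`, the problem is NOT `α`-sharp on the feasible `M`-ball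
  `W_R(z*)`; `not_isSharpOn_sdp_half` is the instance `τ = σ = 1/2` (`norm_Ksdp_le_one`).

Reading for the tree (no claim beyond the theorems): the sharpness hypothesis under which restarted
PDHG is proved linearly convergent holds for LP (`LinearProgramSharpness.isSharpOn_lp`) and for
unconstrained bilinear problems (`isSharpOn_bilinear`), and FAILS already for the smallest strictly
complementary SDP; for spectrahedra only Hölder-type bounds (Theorem 5.1; tree:
`Literature/Computation/Certificates/SturmErrorBound.lean`) are available.
-/

namespace Literature.Analysis.Convex.SemidefiniteSharpnessFailure

open scoped RealInnerProductSpace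
open Literature.Analysis.Convex.PrimalDualHybridGradient (conicL)
open Literature.Analysis.Convex.RestartedPDHG
open Literature.Analysis.Convex.LinearProgramSharpness (cUp cLow cUp_nonneg cLow_pos
  normM_le_cUp_mul cLow_mul_le_normM conicL_eq_inner_primalRes)

/-- Coordinates `x = (X₁₁, X₁₂, X₂₂)` of a real symmetric `2 × 2` matrix `X` (`S² ≅ ℝ³`).
[cite: DrusvyatskiyWolkowicz2017, §5 Example 5.1 (S², n = 2)] -/
abbrev E3 : Type := EuclideanSpace ℝ (Fin 3)

/-- The dual variable space `ℝ¹` of one equality constraint. [cite: ApplegateEtAl2022, §2 (3) (y ∈ ℝᵐ, m = 1)] -/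
abbrev E1 : Type := EuclideanSpace ℝ (Fin 1)

/-- The symmetric matrix `X = (x₀ x₁; x₁ x₂)` with coordinates `x`.
[cite: DrusvyatskiyWolkowicz2017, §5 Example 5.1 (S²)] -/
def sym2 (x : E3) : Matrix (Fin 2) (Fin 2) ℝ := !![x 0, x 1; x 1, x 2]

/-- The cone `S²₊` of positive semidefinite `2 × 2` matrices in the coordinates `x`: the quadratic
form `vᵀ X v = x₀v₀² + 2x₁v₀v₁ + x₂v₁²` is nonnegative. [cite: DrusvyatskiyWolkowicz2017, §5 Example 5.1 (S²₊)] -/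
def psd2 : Set E3 := {x | ∀ v : Fin 2 → ℝ, 0 ≤ x 0 * v 0 ^ 2 + 2 * x 1 * (v 0 * v 1) + x 2 * v 1 ^ 2}

/-- The quadratic form of `sym2 x`. [cite: DrusvyatskiyWolkowicz2017, §5 Example 5.1] -/
theorem quadForm_sym2 (x : E3) (v : Fin 2 → ℝ) :
    dotProduct (star v) ((sym2 x).mulVec v) =
      x 0 * v 0 ^ 2 + 2 * x 1 * (v 0 * v 1) + x 2 * v 1 ^ 2 := by
  simp [sym2, Matrix.mulVec, dotProduct, Fin.sum_univ_two]
  ring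

/-- `sym2 x` is symmetric. [cite: DrusvyatskiyWolkowicz2017, §5 Example 5.1] -/
theorem isHermitian_sym2 (x : E3) : (sym2 x).IsHermitian :=
  Matrix.IsHermitian.ext fun i j => by fin_cases i <;> fin_cases j <;> simp [sym2]

/-- `psd2` is exactly positive semidefiniteness of the symmetric matrix (Mathlib's
`Matrix.PosSemidef`). [cite: DrusvyatskiyWolkowicz2017, §5 Example 5.1 (S²₊)] -/
theorem mem_psd2_iff_posSemidef (x : E3) : x ∈ psd2 ↔ (sym2 x).PosSemidef := by
  rw [Matrix.posSemidef_iff_dotProduct_mulVec]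
  simp only [quadForm_sym2]
  exact ⟨fun h => ⟨isHermitian_sym2 x, h⟩, fun h => h.2⟩

/-- Diagonal entries of a PSD matrix are nonnegative. [cite: DrusvyatskiyWolkowicz2017, §5 Example 5.1] -/
theorem diag_nonneg_of_mem_psd2 {x : E3} (hx : x ∈ psd2) : 0 ≤ x 0 ∧ 0 ≤ x 2 := by
  have h1 := hx ![1, 0]
  have h2 := hx ![0, 1]
  simp at h1 h2
  exact ⟨h1, h2⟩

/-- The mechanism of Example 5.1: `X ⪰ 0` and `X₂₂ = 0` force `X₁₂ = 0`.
[cite: DrusvyatskiyWolkowicz2017, §5 Example 5.1 ("the constraint X₂₂ = 0 forces 0 = X₁₂")] -/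
theorem offDiag_eq_zero_of_mem_psd2 {x : E3} (hx : x ∈ psd2) (h2 : x 2 = 0) : x 1 = 0 := by
  have h := hx ![x 1, -(x 0 / 2 + 1)]
  simp [h2] at h
  nlinarith [sq_nonneg (x 1), (diag_nonneg_of_mem_psd2 hx).1]

/-! ### Example 5.1 (`n = 2`) as printed: no Lipschitz error bound for `S²₊ ∩ {X₂₂ = 0}` -/

/-- The feasible region `F = {X ∈ S²₊ : X₂₂ = 0}`. [cite: DrusvyatskiyWolkowicz2017, §5 Example 5.1 (F_p, n = 2)] -/
def feas2 : Set E3 := psd2 ∩ {x | x 2 = 0}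

/-- The linear (affine) constraint set `V = {X : X₂₂ = 0}`. [cite: DrusvyatskiyWolkowicz2017, §5 Example 5.1 (V)] -/
def lin2 : Set E3 := {x | x 2 = 0}

/-- `F = cone(e₁e₁ᵀ)`: every feasible `X` has `X₁₂ = X₂₂ = 0` (and `X₁₁ ≥ 0`).
[cite: DrusvyatskiyWolkowicz2017, §5 Example 5.1 ("the feasible region coincides with the ray cone(e₁e₁ᵀ)")] -/
theorem mem_feas2_iff (x : E3) : x ∈ feas2 ↔ 0 ≤ x 0 ∧ x 1 = 0 ∧ x 2 = 0 := by
  constructor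
  · rintro ⟨hx, h2⟩
    exact ⟨(diag_nonneg_of_mem_psd2 hx).1, offDiag_eq_zero_of_mem_psd2 hx h2, h2⟩
  · rintro ⟨h0, h1, h2⟩
    refine ⟨fun v => ?_, h2⟩
    rw [h1, h2]
    nlinarith [sq_nonneg (v 0)]

/-- The near-feasible matrices `X(ε) = (1 ε; ε ε²) ⪰ 0` (the printed `X(ε)` of Example 5.1 for
`n = 2`, reparametrised by `ε ↦ ε²` and scaled). [cite: DrusvyatskiyWolkowicz2017, §5 Example 5.1 (X(ε))] -/
noncomputable def xeps (ε : ℝ) : E3 := WithLp.toLp 2 ![1, ε, ε ^ 2]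

/-- `X(ε)₁₁ = 1`. [cite: DrusvyatskiyWolkowicz2017, §5 Example 5.1 (X(ε))] -/
@[simp] theorem xeps_zero (ε : ℝ) : xeps ε 0 = 1 := rfl

/-- `X(ε)₁₂ = ε`. [cite: DrusvyatskiyWolkowicz2017, §5 Example 5.1 (X(ε))] -/
@[simp] theorem xeps_one (ε : ℝ) : xeps ε 1 = ε := rfl

/-- `X(ε)₂₂ = ε²`. [cite: DrusvyatskiyWolkowicz2017, §5 Example 5.1 (X(ε))] -/
@[simp] theorem xeps_two (ε : ℝ) : xeps ε 2 = ε ^ 2 := rfl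

/-- `X(ε) ⪰ 0` (`vᵀX(ε)v = (v₀ + εv₁)²`). [cite: DrusvyatskiyWolkowicz2017, §5 Example 5.1] -/
theorem xeps_mem_psd2 (ε : ℝ) : xeps ε ∈ psd2 := by
  intro v
  simp only [xeps_zero, xeps_one, xeps_two]
  nlinarith [sq_nonneg (v 0 + ε * v 1)]

/-- `dist(X(ε), V) ≤ ε²`: the matrix `(1 ε; ε 0) ∈ V` is at distance `ε²`.
[cite: DrusvyatskiyWolkowicz2017, §5 Example 5.1 ("the distance of X(ε) to V is on the order of ε")] -/
theorem infDist_xeps_lin2_le (ε : ℝ) : Metric.infDist (xeps ε) lin2 ≤ ε ^ 2 := by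
  have hmem : (WithLp.toLp 2 ![1, ε, 0] : E3) ∈ lin2 := by simp [lin2]
  refine (Metric.infDist_le_dist_of_mem hmem).trans ?_
  rw [dist_eq_norm, EuclideanSpace.norm_eq]
  simp [Fin.sum_univ_three, xeps]
  rw [Real.sqrt_sq_eq_abs, abs_of_nonneg (sq_nonneg ε)]

/-- `dist(X(ε), S²₊) = 0`. [cite: DrusvyatskiyWolkowicz2017, §5 Example 5.1] -/
theorem infDist_xeps_psd2 (ε : ℝ) : Metric.infDist (xeps ε) psd2 = 0 :=
  Metric.infDist_zero_of_mem (xeps_mem_psd2 ε)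

/-- `dist(X(ε), F) ≥ |ε|`: every feasible matrix has `X₁₂ = 0`.
[cite: DrusvyatskiyWolkowicz2017, §5 Example 5.1 ("the distance of X(ε) to the solution set is at least on the order of ε^{1/2}")] -/
theorem le_infDist_xeps_feas2 (ε : ℝ) : |ε| ≤ Metric.infDist (xeps ε) feas2 := by
  have hne : feas2.Nonempty := ⟨0, by rw [mem_feas2_iff]; simp⟩
  refine (Metric.le_infDist hne).mpr fun w hw => ?_
  rw [mem_feas2_iff] at hw
  rw [dist_eq_norm]
  have h := PiLp.norm_apply_le (xeps ε - w) 1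
  have e : (xeps ε - w) 1 = ε := by simp [hw.2.1]
  rw [e, Real.norm_eq_abs] at h
  exact h

/-- **[DrusvyatskiyWolkowicz2017, Example 5.1] (`n = 2`): the Hölder exponent of `S²₊ ∩ {X₂₂ = 0}` is
at most `1/2` — no Lipschitzian error bound.** There is no constant `κ` with
`dist(X, F) ≤ κ (dist(X, S²₊) + dist(X, V))` on the unit ball around the feasible point `e₁e₁ᵀ`
(witness `X(ε)`, `ε → 0`: left side `≥ ε`, right side `≤ κ ε²`).
[cite: DrusvyatskiyWolkowicz2017, §5 Example 5.1 (worst-case example, n = 2) with Theorem 5.1] -/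
theorem not_lipschitz_errorBound_psd2 :
    ¬ ∃ κ : ℝ, ∀ x : E3, dist x (xeps 0) ≤ 1 →
      Metric.infDist x feas2 ≤ κ * (Metric.infDist x psd2 + Metric.infDist x lin2) := by
  rintro ⟨κ, hκ⟩
  -- take `ε = min(1/2, 1/(2(|κ|+1)))`
  set ε : ℝ := min (1 / 2) (1 / (2 * (|κ| + 1))) with hε
  have hκ1 : 0 < |κ| + 1 := by positivity
  have hε0 : 0 < ε := by rw [hε]; positivity
  have hε1 : ε ≤ 1 / 2 := min_le_left _ _
  have hε2 : ε ≤ 1 / (2 * (|κ| + 1)) := min_le_right _ _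
  have hball : dist (xeps ε) (xeps 0) ≤ 1 := by
    rw [dist_eq_norm, EuclideanSpace.norm_eq]
    simp [Fin.sum_univ_three, xeps]
    have h2 : ε ^ 2 ≤ 1 / 4 := by nlinarith
    nlinarith
  have h := hκ (xeps ε) hball
  rw [infDist_xeps_psd2, zero_add] at h
  have h1 := le_infDist_xeps_feas2 ε
  rw [abs_of_pos hε0] at h1
  have h2 := infDist_xeps_lin2_le ε
  -- `ε ≤ κ ε²` with `ε ≤ 1/(2(|κ|+1))` is absurd
  have h3 : ε ≤ |κ| * ε ^ 2 := by
    calc ε ≤ κ * Metric.infDist (xeps ε) lin2 := h1.trans h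
      _ ≤ |κ| * Metric.infDist (xeps ε) lin2 :=
          mul_le_mul_of_nonneg_right (le_abs_self κ) Metric.infDist_nonneg
      _ ≤ |κ| * ε ^ 2 := mul_le_mul_of_nonneg_left h2 (abs_nonneg κ)
  have h4 : |κ| * ε ≤ 1 / 2 := by
    calc |κ| * ε ≤ (|κ| + 1) * ε := by nlinarith
      _ ≤ (|κ| + 1) * (1 / (2 * (|κ| + 1))) := mul_le_mul_of_nonneg_left hε2 hκ1.le
      _ = 1 / 2 := by field_simp
  nlinarith

/-! ### The SDP `min X₂₂ s.t. X₁₁ = 1, X ⪰ 0` as a conic saddle, and the failure of sharpness -/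

/-- The constraint map `K X = X₁₁` (one equality constraint).
[cite: DrusvyatskiyWolkowicz2017, §5 Example 5.1 (mechanism); ApplegateEtAl2022, §2 (3) (K)] -/
noncomputable def Ksdp : E3 →L[ℝ] E1 :=
  LinearMap.toContinuousLinearMap
    { toFun := fun x => WithLp.toLp 2 (fun _ : Fin 1 => x 0)
      map_add' := fun x y => by ext i; simp
      map_smul' := fun a x => by ext i; simp }

/-- `(K X) = X₁₁`. [cite: ApplegateEtAl2022, §2 (3) (K)] -/
@[simp] theorem Ksdp_apply (x : E3) (i : Fin 1) : Ksdp x i = x 0 := rfl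

/-- The cost `c = E₂₂`, i.e. `⟨c, x⟩ = X₂₂`. [cite: ApplegateEtAl2022, §2 (3) (c)] -/
noncomputable def csdp : E3 := EuclideanSpace.single 2 1

/-- The right-hand side `b = 1` of `X₁₁ = 1`. [cite: ApplegateEtAl2022, §2 (3) (b)] -/
noncomputable def bsdp : E1 := EuclideanSpace.single 0 1

/-- The primal solution `X* = e₁e₁ᵀ = diag(1, 0)`. [cite: DrusvyatskiyWolkowicz2017, §5 Example 5.1 (cone(e₁e₁ᵀ))] -/
noncomputable def xstar : E3 := EuclideanSpace.single 0 1

/-- The inner product of `E1`. [folklore: ⟨u, v⟩ = u₀v₀ in ℝ¹] -/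
private theorem inner_E1 (u v : E1) : ⟪u, v⟫ = u 0 * v 0 := by
  simp [EuclideanSpace.inner_eq_star_dotProduct, dotProduct, mul_comm]

/-- The Lagrangian of the SDP `min X₂₂ s.t. X₁₁ = 1, X ⪰ 0`:
`L(X, y) = X₂₂ + (X₁₁ − 1) y`. [cite: ApplegateEtAl2022, §2 (3)] -/
theorem conicL_sdp (x : E3) (y : E1) : conicL Ksdp csdp bsdp x y = x 2 + (x 0 - 1) * y 0 := by
  rw [conicL_eq_inner_primalRes, inner_E1]
  simp [csdp, bsdp, EuclideanSpace.inner_single_left]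

/-- `X* ⪰ 0`. [cite: DrusvyatskiyWolkowicz2017, §5 Example 5.1] -/
theorem xstar_mem_psd2 : xstar ∈ psd2 := by
  intro v
  simp [xstar]
  nlinarith [sq_nonneg (v 0)]

/-- **The primal–dual solution set is the single point `(X*, y*) = (e₁e₁ᵀ, 0)`** (unique, with zero
duality gap and strict complementarity: `X* = diag(1,0)`, `S* = c − K*y* = diag(0,1)`).
[cite: ApplegateEtAl2022, §2 (Z* of (3)); DrusvyatskiyWolkowicz2017, §5 Example 5.1 (mechanism)] -/
theorem saddleSet_sdp :
    saddleSet Ksdp psd2 Set.univ csdp bsdp = {((xstar : E3), (0 : E1))} := by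
  ext z
  rw [mem_saddleSet_iff, Set.mem_singleton_iff]
  simp only [conicL_sdp]
  constructor
  · rintro ⟨hx, -, hmin, hmax⟩
    have hd := diag_nonneg_of_mem_psd2 hx
    -- `X₁₁ = 1`: otherwise move `y` in the direction of the residual
    have hx0 : z.1 0 = 1 := by
      by_contra hne
      have h := hmax (z.2 + EuclideanSpace.single 0 (z.1 0 - 1)) (Set.mem_univ _)
      simp at h
      have hpos : 0 < (z.1 0 - 1) ^ 2 := by
        have : z.1 0 - 1 ≠ 0 := sub_ne_zero.mpr hne
        positivity
      nlinarith
    -- `y = 0`: test `X = 2e₁e₁ᵀ` and `X = 0`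
    have hy0 : z.2 0 = 0 := by
      rcases lt_trichotomy (z.2 0) 0 with hlt | heq | hgt
      · have hmem : (EuclideanSpace.single 0 2 : E3) ∈ psd2 := by
          intro v; simp; nlinarith [sq_nonneg (v 0)]
        have h := hmin _ hmem
        simp [hx0] at h
        linarith [hd.2]
      · exact heq
      · have hmem : (0 : E3) ∈ psd2 := by intro v; simp
        have h := hmin 0 hmem
        simp [hx0] at h
        linarith [hd.2]
    -- `X₂₂ = 0`: test `X = X*`
    have hx2 : z.1 2 = 0 := by
      have h := hmin xstar xstar_mem_psd2
      simp [hx0, hy0, xstar] at h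
      linarith [hd.2]
    have hx1 : z.1 1 = 0 := offDiag_eq_zero_of_mem_psd2 hx hx2
    refine Prod.ext ?_ ?_
    · ext i
      fin_cases i <;> simp [xstar, hx0, hx1, hx2]
    · ext i
      fin_cases i
      simp [hy0]
  · rintro rfl
    refine ⟨xstar_mem_psd2, Set.mem_univ _, fun x hx => ?_, fun y _ => ?_⟩
    · simp [xstar]
      exact (diag_nonneg_of_mem_psd2 hx).2
    · simp [xstar]

/-- The feasible near-solutions `z(ε) = (X(ε), 0)`: primal feasible (`X(ε)₁₁ = 1`, `X(ε) ⪰ 0`), dual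
feasible (`y = 0`, `S = E₂₂ ⪰ 0`), complementarity gap `⟨S, X(ε)⟩ = ε²`.
[cite: DrusvyatskiyWolkowicz2017, §5 Example 5.1 (X(ε))] -/
noncomputable def zeps (ε : ℝ) : E3 × E1 := (xeps ε, 0)

/-- **The normalized duality gap at `z(ε)` is `≤ ε²/r`:** `G(z(ε); ζ) = ε² − ζ₂₂ ≤ ε²` for every
feasible `ζ` (`ζ.1 ⪰ 0`). [cite: ApplegateEtAl2022, §2 (4) (ρ_r); DrusvyatskiyWolkowicz2017, §5 Example 5.1 (mechanism)] -/
theorem rho_zeps_le {τ σ r : ℝ} (hr : 0 < r) (ε : ℝ) :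
    rho Ksdp psd2 Set.univ csdp bsdp τ σ r (zeps ε) ≤ r⁻¹ * ε ^ 2 := by
  unfold rho
  refine mul_le_mul_of_nonneg_left ?_ (inv_nonneg.mpr hr.le)
  refine csSup_le ?_ ?_
  · exact ⟨_, ⟨zeps ε, ⟨xeps_mem_psd2 ε, Set.mem_univ _, by rw [sub_self, normM_zero]; exact hr.le⟩,
      rfl⟩⟩
  · rintro _ ⟨ζ, ⟨hζ, -, -⟩, rfl⟩
    show gap Ksdp csdp bsdp (zeps ε) ζ ≤ ε ^ 2
    unfold gap
    rw [conicL_sdp, conicL_sdp]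
    simp [zeps]
    exact (diag_nonneg_of_mem_psd2 hζ).2

/-- The displacement `z(ε) − z*` has Euclidean norm between `|ε|` and `|ε| + ε²`.
[cite: DrusvyatskiyWolkowicz2017, §5 Example 5.1 (distance of X(ε) to the solution set)] -/
theorem norm_zeps_sub :
    ∀ ε : ℝ, |ε| ≤ ‖WithLp.toLp 2 (zeps ε - (xstar, (0 : E1)))‖ ∧
      ‖WithLp.toLp 2 (zeps ε - (xstar, (0 : E1)))‖ ≤ |ε| + ε ^ 2 := by
  intro ε
  have hsq : ‖WithLp.toLp 2 (zeps ε - (xstar, (0 : E1)))‖ ^ 2 = ε ^ 2 + ε ^ 4 := by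
    rw [WithLp.prod_norm_sq_eq_of_L2]
    simp only [WithLp.toLp_fst, WithLp.toLp_snd, zeps, Prod.fst_sub, Prod.snd_sub, sub_zero,
      norm_zero, zero_pow two_ne_zero, add_zero]
    rw [EuclideanSpace.norm_sq_eq]
    simp [Fin.sum_univ_three, xstar, xeps]
    ring
  have hn : 0 ≤ ‖WithLp.toLp 2 (zeps ε - (xstar, (0 : E1)))‖ := norm_nonneg _
  constructor
  · have h : |ε| ^ 2 ≤ ‖WithLp.toLp 2 (zeps ε - (xstar, (0 : E1)))‖ ^ 2 := by
      rw [hsq, sq_abs]; nlinarith [sq_nonneg ε]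
    exact (pow_le_pow_iff_left₀ (abs_nonneg ε) hn two_ne_zero).mp h
  · have h : ‖WithLp.toLp 2 (zeps ε - (xstar, (0 : E1)))‖ ^ 2 ≤ (|ε| + ε ^ 2) ^ 2 := by
      rw [hsq]
      have : ε ^ 2 = |ε| ^ 2 := (sq_abs ε).symm
      nlinarith [abs_nonneg ε, sq_nonneg ε]
    exact (pow_le_pow_iff_left₀ hn (by positivity) two_ne_zero).mp h

/-- **Semidefinite programs are not sharp** (the `n = 2` mechanism of [DrusvyatskiyWolkowicz2017,
Example 5.1] read through [ApplegateEtAl2022, Definition 1]): for the SDP `min X₂₂ s.t. X₁₁ = 1,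
X ⪰ 0` — unique primal–dual solution `z* = (e₁e₁ᵀ, 0)`, zero duality gap, strict complementarity —
the conic saddle is NOT `α`-sharp on the feasible `M`-ball `W_R(z*)` for ANY `α > 0`, `R > 0` and any
PDHG steps `τ, σ > 0` with `τσ‖K‖² < 1`: the feasible points `z(ε) = (X(ε), 0)` have normalized duality
gap `ρ_r(z(ε)) ≤ ε²/r` but `dist_M(z(ε), Z*) ≥ c↓ ε`. Hence the hypothesis of
`RestartedPDHG.infDistM_iterate_avgPDHG_le_pow` (Theorem 1 of [ApplegateEtAl2022]) fails for this SDP,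
in contrast with LP (`LinearProgramSharpness.isSharpOn_lp`).
[cite: DrusvyatskiyWolkowicz2017, §5 Example 5.1 (n = 2) with Theorem 5.1; ApplegateEtAl2022, Definition 1] -/
theorem not_isSharpOn_sdp {τ σ : ℝ} (hτ : 0 < τ) (hσ : 0 < σ) (hK : τ * σ * ‖Ksdp‖ ^ 2 < 1)
    {α R : ℝ} (hα : 0 < α) (hR : 0 < R) :
    ¬ IsSharpOn Ksdp psd2 Set.univ csdp bsdp τ σ
        (ballM Ksdp psd2 Set.univ τ σ (xstar, (0 : E1)) R) α := by
  intro hsharp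
  set zs : E3 × E1 := (xstar, (0 : E1)) with hzs
  set cU := cUp Ksdp τ σ with hcU
  set cL := cLow Ksdp τ σ with hcL
  have hcU0 : 0 ≤ cU := cUp_nonneg Ksdp τ σ
  have hcL0 : 0 < cL := cLow_pos Ksdp hτ hσ hK
  have hzs_mem : zs ∈ ballM Ksdp psd2 Set.univ τ σ zs R :=
    ⟨xstar_mem_psd2, Set.mem_univ _, by rw [sub_self, normM_zero]; exact hR.le⟩
  -- a second point of the ball in the `y`-direction gives a positive admissible radius `r₀`
  set s : ℝ := R / (cU + 1) with hs
  have hs0 : 0 < s := by positivity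
  set v : E3 × E1 := (xstar, EuclideanSpace.single 0 s) with hv
  have hvnorm : ‖WithLp.toLp 2 (v - zs)‖ = s := by
    have hsq : ‖WithLp.toLp 2 (v - zs)‖ ^ 2 = s ^ 2 := by
      rw [WithLp.prod_norm_sq_eq_of_L2]
      simp only [WithLp.toLp_fst, WithLp.toLp_snd, hv, hzs, Prod.fst_sub, Prod.snd_sub, sub_self,
        norm_zero, sub_zero, zero_pow two_ne_zero, zero_add]
      rw [EuclideanSpace.norm_sq_eq]
      simp [Real.norm_eq_abs, sq_abs]
    have h := (pow_left_inj₀ (norm_nonneg _) hs0.le two_ne_zero).mp hsq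
    exact h
  have hv_mem : v ∈ ballM Ksdp psd2 Set.univ τ σ zs R := by
    refine ⟨xstar_mem_psd2, Set.mem_univ _, ?_⟩
    calc normM Ksdp τ σ (v - zs) ≤ cU * ‖WithLp.toLp 2 (v - zs)‖ := normM_le_cUp_mul Ksdp hτ hσ _
      _ = cU * s := by rw [hvnorm]
      _ ≤ (cU + 1) * s := by nlinarith
      _ = R := by rw [hs]; field_simp
  set r₀ : ℝ := cL * s with hr₀
  have hr₀0 : 0 < r₀ := mul_pos hcL0 hs0
  have hr₀diam : r₀ ≤ diamM Ksdp τ σ (ballM Ksdp psd2 Set.univ τ σ zs R) := by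
    calc r₀ = cL * ‖WithLp.toLp 2 (v - zs)‖ := by rw [hvnorm]
      _ ≤ normM Ksdp τ σ (v - zs) := cLow_mul_le_normM Ksdp hτ hσ hK.le _
      _ ≤ diamM Ksdp τ σ (ballM Ksdp psd2 Set.univ τ σ zs R) :=
          normM_sub_le_diamM_ballM Ksdp hτ hσ hK.le zs R hv_mem hzs_mem
  -- the test point `z(ε)` with `ε` small
  set ε : ℝ := min (1 / 2) (min (R / (2 * (cU + 1))) (α * cL * r₀ / 2)) with hε
  have hε0 : 0 < ε := by rw [hε]; positivity
  have hε1 : ε ≤ 1 / 2 := min_le_left _ _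
  have hε2 : ε ≤ R / (2 * (cU + 1)) := (min_le_right _ _).trans (min_le_left _ _)
  have hε3 : ε ≤ α * cL * r₀ / 2 := (min_le_right _ _).trans (min_le_right _ _)
  obtain ⟨hlow, hup⟩ := norm_zeps_sub ε
  rw [abs_of_pos hε0] at hlow hup
  have hzeps_mem : zeps ε ∈ ballM Ksdp psd2 Set.univ τ σ zs R := by
    refine ⟨xeps_mem_psd2 ε, Set.mem_univ _, ?_⟩
    calc normM Ksdp τ σ (zeps ε - zs) ≤ cU * ‖WithLp.toLp 2 (zeps ε - zs)‖ :=
          normM_le_cUp_mul Ksdp hτ hσ _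
      _ ≤ cU * (ε + ε ^ 2) := mul_le_mul_of_nonneg_left hup hcU0
      _ ≤ cU * (2 * ε) := mul_le_mul_of_nonneg_left (by nlinarith) hcU0
      _ ≤ (cU + 1) * (2 * ε) := by nlinarith
      _ ≤ (cU + 1) * (2 * (R / (2 * (cU + 1)))) := by
          have : 0 < cU + 1 := by positivity
          nlinarith
      _ = R := by field_simp
  -- sharpness at `z(ε)` with radius `r₀`
  have hS := hsharp (zeps ε) hzeps_mem r₀ hr₀0 hr₀diam
  rw [saddleSet_sdp] at hS
  have hdist : infDistM Ksdp τ σ (zeps ε) {zs} = normM Ksdp τ σ (zeps ε - zs) := by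
    unfold infDistM
    rw [Set.image_singleton, csInf_singleton]
  rw [← hzs, hdist] at hS
  have hρ := rho_zeps_le (τ := τ) (σ := σ) hr₀0 ε
  have hM : cL * ε ≤ normM Ksdp τ σ (zeps ε - zs) :=
    (mul_le_mul_of_nonneg_left hlow hcL0.le).trans (cLow_mul_le_normM Ksdp hτ hσ hK.le _)
  -- `α c↓ ε ≤ ε²/r₀`, i.e. `α c↓ r₀ ≤ ε`, contradicting `ε ≤ α c↓ r₀ / 2`
  have h1 : α * (cL * ε) ≤ r₀⁻¹ * ε ^ 2 :=
    (mul_le_mul_of_nonneg_left hM hα.le).trans (hS.trans hρ)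
  have h2 : α * cL * r₀ * ε ≤ ε ^ 2 := by
    have := mul_le_mul_of_nonneg_left h1 hr₀0.le
    rw [mul_inv_cancel_left₀ hr₀0.ne'] at this
    calc α * cL * r₀ * ε = r₀ * (α * (cL * ε)) := by ring
      _ ≤ ε ^ 2 := this
  have h3 : α * cL * r₀ ≤ ε := by
    have := h2
    nlinarith [mul_pos (mul_pos hα hcL0) hr₀0]
  have h4 : 0 < α * cL * r₀ := mul_pos (mul_pos hα hcL0) hr₀0
  linarith

/-- `‖K‖ ≤ 1` for `K X = X₁₁`, so every `τ, σ > 0` with `τσ < 1` is an admissible PDHG step pair for the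
example. [cite: ApplegateEtAl2022, §2 (step sizes τσ‖K‖² < 1)] -/
theorem norm_Ksdp_le_one : ‖Ksdp‖ ≤ 1 := by
  refine ContinuousLinearMap.opNorm_le_bound _ zero_le_one fun x => ?_
  rw [one_mul, EuclideanSpace.norm_eq]
  simp only [Ksdp_apply, Real.norm_eq_abs, sq_abs, Finset.univ_unique, Fin.default_eq_zero,
    Finset.sum_singleton]
  rw [Real.sqrt_sq_eq_abs, ← Real.norm_eq_abs]
  exact PiLp.norm_apply_le x 0

/-- **Concrete instance** (steps `τ = σ = 1/2`): the SDP saddle of `min X₂₂ s.t. X₁₁ = 1, X ⪰ 0` is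
not `α`-sharp on any feasible `M`-ball around its solution, for any `α > 0`.
[cite: DrusvyatskiyWolkowicz2017, §5 Example 5.1 (n = 2); ApplegateEtAl2022, Definition 1] -/
theorem not_isSharpOn_sdp_half {α R : ℝ} (hα : 0 < α) (hR : 0 < R) :
    ¬ IsSharpOn Ksdp psd2 Set.univ csdp bsdp (1 / 2) (1 / 2)
        (ballM Ksdp psd2 Set.univ (1 / 2) (1 / 2) (xstar, (0 : E1)) R) α := by
  refine not_isSharpOn_sdp (by norm_num) (by norm_num) ?_ hα hR
  have h := norm_Ksdp_le_one
  have h0 := norm_nonneg Ksdp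
  nlinarith

end Literature.Analysis.Convex.SemidefiniteSharpnessFailure
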